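import Summits.QuantumFields.YangMills.Theorems.UnitScaleTiltProp7H1GradientRowOfLetters
import Summits.QuantumFields.YangMills.Theorems.UnitScaleTiltProp7GreenOneSupRowsOfLetters
import Summits.QuantumFields.YangMills.Theorems.UnitScaleTiltProp7TJSlotCoerciveClosedAllMembers
import Summits.QuantumFields.YangMills.Theorems.UnitScaleTiltProp7GreenOneGradientFamily
import Summits.QuantumFields.YangMills.Theorems.UnitScaleTiltProp7OneFormGreenSupRowsAllMembers
import Summits.QuantumFields.YangMills.Theorems.UnitScaleTiltProp7GaugeProjectorC2SupAllMembers
import Summits.QuantumFields.YangMills.Theorems.UnitScaleTiltProp7ChainPotentialHessianAllMembers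
import Summits.QuantumFields.YangMills.Theorems.UnitScaleTiltProp7OneFormGreenBlockGradientFamilyAllMembers
import Summits.QuantumFields.YangMills.Theorems.UnitScaleTiltProp7OneFormCoerciveHolds
import HarnessLib

/-!
# Route `UnitScaleTilt`, crux K1 «MinimiserStabilityRegPr» (stmt-QuantumFields-19200), EX row (6) `norm_H₁` (S47 ✓p766895), its ∇-HALF — **(∇1)-FAMILY, R-EDITION (NO ROOM): THE (115)-GRADIENT ROW OF
# `G₁ = G_T(Δ₁ᴾ(T_Jᴾ))` ON SUP-BOUNDED SOURCES FOR ALL MEMBERS, L-ONLY CONSTANTS, MODULO px19's `hqG`** (generated from ✓`Prop7GreenOneGradientFamily` by `gen/gen_oR.py`: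
# the ROOM antecedent deleted, the three room-carrying suppliers swapped to their landed `_allMembers` editions — T3-R ✓`Prop7TJSlotCoerciveClosedAllMembers`, T1-R
# ✓`Prop7TJRowsFamilyOfH133AllMembers`, K6-h133-R ✓`Prop7H133FamilyPackageAllMembers`; NO other token of the statement touched) — the `Δ₁ᴾ(T_Jᴾ)`-slot twin of px21 g16's ✓`Prop7GreenPiGradientFamily.gradient_GTpi_family_exists`
# (★★OWNER g36 ■ FINAL NOTICE (1) pen O2 «row (6) ∇-half at Δ₁ by generator»; px17 g12 14:56:00Z «Π-only fine, I re-run at Δ₁»): this lineage's (∇1)-KNIT ✓`Prop7GreenOneGradientRowOfLetters.gradient_row_GTone_of_letters`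
# (read in the `(X, s)` currency ✓`Prop7H1GradientRowOfLetters.gradient_row_GTone_of_letters_sup`) AT EVERY MEMBER `i : Idx L`, each of its letters FED BY ITS LANDED FAMILY:
# `PosOnto(η)` ⟸ ✓`hco_DeltaEtaSlot_exists` ∘ ✓`posOnto_of_coercive`; `PosOnto(Δ₁ᴾ(T_Jᴾ))` ⟸ px12 ✓`Prop7TJSlotCoerciveClosed.hco_DeltaOnePJ_exists`; (V1)(Div1) ⟸ this lineage's O-G1
# ✓`Prop7GreenOneSupRowsOfLetters.valueDiv_rows_GTone_of_letters` over FILE C's `hV hDiv` ⟸ px21 ✓`valueDiv_GT_DeltaEtaSlot_sup_family_allMembers`; (c1)(c3) ⟸ ✓`hc1_hc3_sup_family`; (c2) ⟸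
# ✓`hc2_sup_family_allMembers`; (tJ) ⟸ px12 ✓`tjValueRows_exists` conj. 1 (T-sup-lin at `ρ' := αG L`); (tJd) ⟸ px12 ✓`Prop7TJRowsFamilyOfH133.tjDivRows_family_of_h133_hqG` (TDw-lin at rate `δ := 0`)
# fed ✓`h133_family_exists` — DISPLAYING px19's `hqG` letter VERBATIM (the one open input of the J-slot road); (∇0) ⟸ px21 ✓`gradient_GT_DeltaEtaSlot_family_allMembers`; (H∇) ⟸
# ✓`hessRow_chain_family_allMembers`; the α-window ⟸ the cap (§1).

Cell `ym3-torus` (HUMAN RULING D-0037; rung R3 = SU(2) YM₃ on T³ — NOT d = 4, NOT infinite volume, NOT a mass gap, NOT Clay).  Width seat `ym3-torus-px17` (gen 13).  THEOREMS ONLY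
(0 `def`, 0 `sorry`; ONE decl-local `maxHeartbeats 400000` on the theorem, disclosed — the knit measures ≈ 120k–150k in the ROOM edition); `--supports stmt-QuantumFields-19200 --as helper`; count-neutral.

WHAT IS PROVED (ns `Summit.QuantumFields.YangMills.Theorems.Prop7GreenOneGradientFamilyAllMembers`; §1 `hwinJ_of_cap` is IMPORTED from the ROOM edition, not restated).
* ★★★ `gradient_GTone_family_exists_allMembers` — for L-only weights `c₀ cB : ℕ → ℝ` (positive), a coupling window `0 < a₀ ≤ a₁` and px19's `hqG` letter (`αq qG hαq hqG hqGrow`, T1's binder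
  VERBATIM): `∃ αG BG₁ : ℕ → ℝ` (cap with the three windows of record, `αG ≤ αq`, `αG ≤ 1`, `0 ≤ BG₁`) such that for every `L > 1`, member `i : Idx L`, background `U₀` with `RegPr ρ U₀`,
  `ρ ≤ αG L`, under `Lift`, WITH NO ROOM ANTECEDENT, every coupling `a₀(c₀∕cB)ℓ³ ≤ a ≤ a₁(c₀∕cB)ℓ³`:
  `∀ X s, (∀ b, ‖X b‖ ≤ s) → ‖nabla115 ((L⁻¹)^(K−n)) (bgOfCfg U₀) (fun q => toL2⁻¹(G₁(toL2 X)) (bondEquiv⁻¹ q))‖ ≤ BG₁ L * s`, `G₁ = GT … a (DeltaOneP … a (TJSlotP … a)) U₀` — the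
  `hGx` slot of px21's slot-generic ✓`gradient_row_HT_of_gradient_row` at the J-slot for every member, i.e. the (∇1) letter list of row (6)'s ∇-half DISCHARGED modulo `hqG`.
HYP-SAT (★★OWNER RULING №42).  Displayed: `RegPr`∕cap∕`Lift`∕coupling window (classes of record) and `hqG` (px19's averaged-Hessian q-row — a real inequality between displayed terms,
inhabited at `U₀ = 1`, the one open input of the J-slot road per px12 g18 15:58:49Z; chair: disprover-first on FR₂-lite); every other letter of the member theorem is discharged by a landed
family; conclusion non-vacuous; no `Prop` placeholder.
HONEST SCOPE.  An `∃`-assembly over landed families; constants EXISTENTIAL-but-L-only; nothing of `hqG`, `norm_H₁`'s value half, `norm_H₁`, `norm_G`, the EX rows, EX or the crux is proved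
here; no summit is proved by a helper; rung R3 = SU(2) YM₃ on T³ — NOT d = 4, NOT infinite volume, NOT a mass gap, NOT Clay; the Yang–Mills mass gap is NOT proved.

References: T. Bałaban, CMP **99** (1985) 389–434 [Balaban1985BackgroundPropagators] ((3.3) p.391, (3.117)–(3.122) pp.419–420, (3.128)–(3.138) pp.421–423, Thm 3.12 p.423, Thm 3.13 p.426);
CMP **102** (1985) 277–309 [Balaban1985Variational] (Thm 1 p.279 (L-only constants), (110)–(111) p.294, (115)–(117) pp.294–295).
-/

set_option autoImplicit false

noncomputable section

open scoped Matrix.Norms.L2Operator BigOperators InnerProductSpace ComplexConjugate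

namespace Summit.QuantumFields.YangMills.Theorems.Prop7GreenOneGradientFamilyAllMembers

open Literature.MathematicalPhysics.QuantumFieldTheory.Balaban1983to89
open Literature.MathematicalPhysics.QuantumFieldTheory.Balaban1983to89.T3ContinuumYM3Torus
open Literature.MathematicalPhysics.QuantumFieldTheory.Balaban1983to89.T3Thm1Carrier (Idx)
open Literature.MathematicalPhysics.QuantumFieldTheory.Balaban1983to89.T3PrintedRegularMinimiser (RegPr)
open Literature.MathematicalPhysics.QuantumFieldTheory.Balaban1983to89.T3PrintedMinimiserExistence (regPr_mono)
open B15DeterminingSets (embIter)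
open T3SectALandauChart (bgUnits)
open B9SectCLatticeCarrier (Bond)
open B11Eq111FrakG (nabla115)
open B11Eq103H1Complex (SiteL2K BondL2K)
open B5Eq118OneStroke (iterBlockOf)
open Summit.QuantumFields.YangMills.Theorems.Prop8Chart (emlIterU)
open Summit.QuantumFields.YangMills.Theorems.Prop7SectET3Transport (periodsT3 bondEquiv bgOfCfg)
open Summit.QuantumFields.YangMills.Theorems.Prop7SectET3HilbertLetters (W₂ toL2 toL2S DL2 DstarL2)
open Summit.QuantumFields.YangMills.Theorems.Prop7SectET3GaugeProjector (RS)
open Summit.QuantumFields.YangMills.Theorems.Prop7SectET3WilsonHessian (DeltaEtaSlot)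
open Summit.QuantumFields.YangMills.Theorems.Prop7SectET3CurvedPropagators (GT PosOnto)
open Summit.QuantumFields.YangMills.Theorems.Prop7SectET3DeltaPiPInv (GprimeP)
open Summit.QuantumFields.YangMills.Theorems.Prop7SectET3DeltaOne (avgHess)
open Summit.QuantumFields.YangMills.Theorems.Prop7SectET3DeltaOnePInv (DeltaOneP TJSlotP)
open Summit.QuantumFields.YangMills.Theorems.Prop7CurvedMemberLocalGradient (exists_curved_localGradient)
open Summit.QuantumFields.YangMills.Theorems.Prop7OneFormCoerciveHolds (hco_DeltaEtaSlot_exists posOnto_of_coercive)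
open Summit.QuantumFields.YangMills.Theorems.Prop7OneFormGreenSupRowsAllMembers (valueDiv_GT_DeltaEtaSlot_sup_family_allMembers)
open Summit.QuantumFields.YangMills.Theorems.Prop7ChainPotentialHessianFamily (alphaH_pos hc1_hc3_sup_family)
open Summit.QuantumFields.YangMills.Theorems.Prop7GaugeProjectorC2SupAllMembers (hc2_sup_family_allMembers)
open Summit.QuantumFields.YangMills.Theorems.Prop7ChainPotentialHessianAllMembers (hessRow_chain_family_allMembers)
open Summit.QuantumFields.YangMills.Theorems.Prop7OneFormGreenBlockGradientFamilyAllMembers (gradient_GT_DeltaEtaSlot_family_allMembers)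
open Summit.QuantumFields.YangMills.Theorems.Prop7TJSlotCoerciveClosedAllMembers (tjValueRows_exists_allMembers hco_DeltaOnePJ_exists_allMembers)
open Summit.QuantumFields.YangMills.Theorems.Prop7GreenOneGradientFamily (hwinJ_of_cap)
open Summit.QuantumFields.YangMills.Theorems.Prop7H133FamilyPackageAllMembers (h133_family_exists_allMembers)
open Summit.QuantumFields.YangMills.Theorems.Prop7TJRowsFamilyOfH133AllMembers (tjDivRows_family_of_h133_hqG_allMembers)
open Summit.QuantumFields.YangMills.Theorems.Prop7GreenOneSupRowsOfLetters (valueDiv_rows_GTone_of_letters)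
open Summit.QuantumFields.YangMills.Theorems.Prop7H1GradientRowOfLetters (gradient_row_GTone_of_letters_sup)

/-! ## ★★★ The (∇1) row for ALL members (no room), modulo `hqG` -/

set_option maxHeartbeats 400000 in -- HEARTBEAT BUDGET (README owner rule 2026-08-28): the nine-family knit elaborates in ≈ 120k–150k heartbeats (twin: fails at 100k, passes at 150k); decl-local, line-neutral.
/-- ★★★ **THE (∇1) ROW OF `G₁ = G_T(Δ₁ᴾ(T_Jᴾ))` ON SUP-BOUNDED SOURCES FOR ALL MEMBERS — NO ROOM — L-ONLY CONSTANTS, MODULO `hqG`** (R-edition of ✓`gradient_GTone_family_exists`: the ROOM antecedent deleted, suppliers ↦ `_allMembers`) — ✓`gradient_row_GTone_of_letters_sup` at every member,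
its letters fed by the landed families (`PosOnto` ×2, (V1)(Div1) via ✓`valueDiv_rows_GTone_of_letters` over FILE C's `hV hDiv`, (c1)(c2)(c3), (tJ), (tJd) modulo `hqG`, (∇0), (H∇), the
window §1); `∃ αG BG₁ : ℕ → ℝ` with the three windows of record, `αG ≤ αq`, `αG ≤ 1`.
[cite: Balaban1985BackgroundPropagators, (3.3) p.391, (3.117)–(3.122) pp.419–420, (3.128)–(3.138) pp.421–423, Thm 3.12 p.423, Thm 3.13 p.426; Balaban1985Variational, Thm 1 p.279, (110)–(111) p.294, (115)–(117) pp.294–295] -/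
theorem gradient_GTone_family_exists_allMembers [hFL : ∀ F : T3Family, Fact (0 < (F.L : ℝ))] [hFη : ∀ (F : T3Family) (k : ℕ), Fact (0 < ((F.L : ℝ)⁻¹) ^ k)]
    (c₀ cB : ℕ → ℝ) [hc₀ : ∀ L : ℕ, Fact (0 < c₀ L)] [hcB : ∀ L : ℕ, Fact (0 < cB L)] {a₀ a₁ : ℝ} (ha₀ : 0 < a₀) (ha₀₁ : a₀ ≤ a₁)
    (αq qG : ℕ → ℝ) (hαq : ∀ L : ℕ, 1 < L → 0 < αq L) (hqG : ∀ L : ℕ, 1 < L → 0 ≤ qG L)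
    (hqGrow : ∀ (L : ℕ), 1 < L → ∀ (i : Idx L) (U₀ : GaugeField (i.1.1.P i.1.2.2) 0 (Matrix.specialUnitaryGroup (Fin 2) ℂ)), RegPr i.1.1 i.1.2.1 i.1.2.2 (αq L) U₀ →
      ∀ (X' : PBond (i.1.1.P i.1.2.2) 0 → Matrix (Fin 2) (Fin 2) ℂ) (s : ℝ) (x : Site (i.1.1.P i.1.2.2) 0) (A : Matrix (Fin 2) (Fin 2) ℂ), (∀ b, ‖X' b‖ ≤ s) →
        ∑ y : PBond (i.1.1.P i.1.2.1) 0, ‖avgHess i.1.1 i.1.2.1 i.1.2.2 i.2.2.le U₀ X'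
            ((toL2 i.1.1 i.1.2.2 (c₀ L)).symm (DL2 i.1.1 i.1.2.1 i.1.2.2 (c₀ L) U₀ (toL2S i.1.1 i.1.2.2 (c₀ L) (Pi.single x A)))) y‖
          ≤ qG L * ((L : ℝ) ^ (i.1.2.2 - i.1.2.1))⁻¹ * s * ‖A‖) :
    ∃ (αG BG₁ : ℕ → ℝ),
      (∀ L : ℕ, 1 < L → 0 < αG L) ∧ (∀ L : ℕ, 1 < L → 10 ^ 12 * (L : ℝ) ^ 3 * αG L ≤ 1) ∧ (∀ L : ℕ, 1 < L → 10 ^ 10 * (L : ℝ) ^ 6 * αG L ≤ 1) ∧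
      (∀ L : ℕ, 1 < L → 13 * 10 ^ 14 * (L : ℝ) ^ 3 * αG L ≤ 1) ∧ (∀ L : ℕ, 1 < L → αG L ≤ αq L) ∧ (∀ L : ℕ, 1 < L → αG L ≤ 1) ∧ (∀ L : ℕ, 1 < L → 0 ≤ BG₁ L) ∧
    ∀ (L : ℕ), 1 < L → ∀ (i : Idx L) (U₀ : GaugeField (i.1.1.P i.1.2.2) 0 (Matrix.specialUnitaryGroup (Fin 2) ℂ)), ∀ ρ : ℝ, RegPr i.1.1 i.1.2.1 i.1.2.2 ρ U₀ → ρ ≤ αG L →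
        (∀ cf : Site (i.1.1.P i.1.2.2) (i.1.2.2 - i.1.2.1) → Matrix (Fin 2) (Fin 2) ℂ,
        (∀ e' : PBond (i.1.1.P i.1.2.2) (i.1.2.2 - i.1.2.1), cf e'.src = ((emlIterU (i.1.2.2 - i.1.2.1) (bgUnits i.1.1 i.1.2.2 U₀) e' : (Matrix (Fin 2) (Fin 2) ℂ)ˣ) : Matrix (Fin 2) (Fin 2) ℂ) * cf e'.tgt *
        (((emlIterU (i.1.2.2 - i.1.2.1) (bgUnits i.1.1 i.1.2.2 U₀) e')⁻¹ : (Matrix (Fin 2) (Fin 2) ℂ)ˣ) : Matrix (Fin 2) (Fin 2) ℂ)) →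
        ∃ l₀ : Site (i.1.1.P i.1.2.2) 0 → Matrix (Fin 2) (Fin 2) ℂ,
        (∀ b' : PBond (i.1.1.P i.1.2.2) 0, l₀ b'.src = ((bgUnits i.1.1 i.1.2.2 U₀ b' : (Matrix (Fin 2) (Fin 2) ℂ)ˣ) : Matrix (Fin 2) (Fin 2) ℂ) * l₀ b'.tgt * (((bgUnits i.1.1 i.1.2.2 U₀ b')⁻¹ : (Matrix (Fin 2) (Fin 2) ℂ)ˣ) : Matrix (Fin 2) (Fin 2) ℂ)) ∧
        ∀ y : Site (i.1.1.P i.1.2.2) (i.1.2.2 - i.1.2.1), l₀ (embIter (i.1.2.2 - i.1.2.1) y) = cf y) →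
      ∀ a : ℝ, a₀ * (c₀ L / cB L) * ((i.1.1.L : ℝ) ^ (i.1.2.2 - i.1.2.1)) ^ 3 ≤ a → a ≤ a₁ * (c₀ L / cB L) * ((i.1.1.L : ℝ) ^ (i.1.2.2 - i.1.2.1)) ^ 3 →
      ∀ (X : PBond (i.1.1.P i.1.2.2) 0 → Matrix (Fin 2) (Fin 2) ℂ) (s : ℝ), (∀ b, ‖X b‖ ≤ s) →
        ‖nabla115 (((i.1.1.L : ℝ)⁻¹) ^ (i.1.2.2 - i.1.2.1)) (bgOfCfg i.1.1 i.1.2.2 U₀)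
            (fun q : Bond 3 (periodsT3 i.1.1 i.1.2.2) => (toL2 i.1.1 i.1.2.2 (c₀ L)).symm (GT i.1.1 i.1.2.1 i.1.2.2 i.2.2.le (c₀ L) (cB L) a
              (DeltaOneP i.1.1 i.1.2.1 i.1.2.2 i.2.2.le (c₀ L) (cB L) a (TJSlotP i.1.1 i.1.2.1 i.1.2.2 i.2.2.le (c₀ L) (cB L) a)) U₀ (toL2 i.1.1 i.1.2.2 (c₀ L) X)) ((bondEquiv i.1.1 i.1.2.2).symm q))‖
          ≤ BG₁ L * s := by
  classical
  -- the landed families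
  obtain ⟨αco, γco, hαco, hWco, hwinco, hγco, hco⟩ := hco_DeltaEtaSlot_exists c₀ cB ha₀
  obtain ⟨αcJ, γcJ, hαcJ, hWcJ, hwincJ, hγcJ, hcoJ⟩ := hco_DeltaOnePJ_exists_allMembers c₀ cB ha₀ ha₀₁
  obtain ⟨αS, BV, BD, hαS, hWS12, hWS10, hWS13, hBV, hBD, hS⟩ := valueDiv_GT_DeltaEtaSlot_sup_family_allMembers c₀ cB ha₀ ha₀₁
  obtain ⟨C₁, C₃, hC₁, hC₃, hc13⟩ := hc1_hc3_sup_family c₀ cB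
  obtain ⟨C₂, hC₂, hc2⟩ := hc2_sup_family_allMembers c₀ cB
  obtain ⟨αH, BH, hαH, hWH, hBH, hHD⟩ := hessRow_chain_family_allMembers c₀ cB
  obtain ⟨αN, BG, hαN, hWN12, hWN10, hWN13, hBG, hG0⟩ := gradient_GT_DeltaEtaSlot_family_allMembers c₀ cB ha₀ ha₀₁
  obtain ⟨αT, MT, hαT, hWT12, hWT10, hWT13, hWT16, hαT1, hMT, hT⟩ := tjValueRows_exists_allMembers c₀ cB ha₀ ha₀₁
  obtain ⟨αK, CH, δH, hαK, hWK12, hWK10, hWK13, hαK1, hCH, hδH, h133⟩ := h133_family_exists_allMembers c₀ cB ha₀ ha₀₁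
  obtain ⟨αD, MD, hαD, hWD12, hWD10, hWD13, hαDK, hαDq, hαD1, hMD, hD⟩ :=
    tjDivRows_family_of_h133_hqG_allMembers c₀ cB αK CH δH hαK hWK12 hWK10 hWK13 hCH hδH h133 αq qG hαq hqG hqGrow
  -- the window modulus and the cap
  set W : ℕ → ℝ := fun L => 4 * C₁ L * (BV L + BD L) + ((12 + MD L) * C₃ L * (1 + C₂ L + 4 * C₁ L * (BV L + BD L)) + MT L * (BV L + BD L)) * (1 + C₂ L) with hWd
  have hW0 : ∀ L : ℕ, 1 < L → 0 ≤ W L := fun L hL => by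
    have := hC₁ L hL; have := hC₂ L hL; have := hC₃ L hL; have := hBV L hL; have := hBD L hL; have := hMT L hL; have := hMD L hL
    simp only [hWd]; positivity
  set αG : ℕ → ℝ := fun L =>
    min (min (min (min (αco L) (αcJ L)) (min (αS L) (αN L))) (min (min (αH L) (min (αT L) (αD L)))
      (min (1 / (10 ^ 12 * (L : ℝ) ^ 3)) (1 / (2 * ((exists_curved_localGradient.choose + 1) * (48 * (6 * Real.sqrt 2 * Real.sqrt 10 + 6 * Real.sqrt 2))))))))
    (min 1 (1 / (2 * W L + 1))) with hαG
  have hαG0 : ∀ L : ℕ, 1 < L → 0 < αG L := fun L hL => by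
    have := hαco L hL; have := hαcJ L hL; have := hαS L hL; have := hαN L hL; have := hαH L hL; have := hαT L hL; have := hαD L hL
    have := alphaH_pos L hL; have := hW0 L hL
    simp only [hαG]
    refine lt_min (lt_min (lt_min (lt_min ‹_› ‹_›) (lt_min ‹_› ‹_›)) (lt_min (lt_min ‹_› (lt_min ‹_› ‹_›)) ‹_›)) (lt_min one_pos (by positivity))
  have hαco' : ∀ L, αG L ≤ αco L := fun L => by
    simp only [hαG]; exact (min_le_left _ _).trans ((min_le_left _ _).trans ((min_le_left _ _).trans (min_le_left _ _)))
  have hαcJ' : ∀ L, αG L ≤ αcJ L := fun L => by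
    simp only [hαG]; exact (min_le_left _ _).trans ((min_le_left _ _).trans ((min_le_left _ _).trans (min_le_right _ _)))
  have hαS' : ∀ L, αG L ≤ αS L := fun L => by
    simp only [hαG]; exact (min_le_left _ _).trans ((min_le_left _ _).trans ((min_le_right _ _).trans (min_le_left _ _)))
  have hαN' : ∀ L, αG L ≤ αN L := fun L => by
    simp only [hαG]; exact (min_le_left _ _).trans ((min_le_left _ _).trans ((min_le_right _ _).trans (min_le_right _ _)))
  have hαH' : ∀ L, αG L ≤ αH L := fun L => by
    simp only [hαG]; exact (min_le_left _ _).trans ((min_le_right _ _).trans ((min_le_left _ _).trans (min_le_left _ _)))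
  have hαT' : ∀ L, αG L ≤ αT L := fun L => by
    simp only [hαG]; exact (min_le_left _ _).trans ((min_le_right _ _).trans ((min_le_left _ _).trans ((min_le_right _ _).trans (min_le_left _ _))))
  have hαD' : ∀ L, αG L ≤ αD L := fun L => by
    simp only [hαG]; exact (min_le_left _ _).trans ((min_le_right _ _).trans ((min_le_left _ _).trans ((min_le_right _ _).trans (min_le_right _ _))))
  have hαX' : ∀ L, αG L ≤ min (1 / (10 ^ 12 * (L : ℝ) ^ 3)) (1 / (2 * ((exists_curved_localGradient.choose + 1) * (48 * (6 * Real.sqrt 2 * Real.sqrt 10 + 6 * Real.sqrt 2))))) := fun L => by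
    simp only [hαG]; exact (min_le_left _ _).trans ((min_le_right _ _).trans (min_le_right _ _))
  have hα1 : ∀ L, αG L ≤ 1 := fun L => by simp only [hαG]; exact (min_le_right _ _).trans (min_le_left _ _)
  have hαW : ∀ L, αG L ≤ 1 / (2 * W L + 1) := fun L => by simp only [hαG]; exact (min_le_right _ _).trans (min_le_right _ _)
  refine ⟨αG, fun L =>
    (BG L * (1 + 4 * αG L * C₁ L * (2 * (BV L + BD L)) + (4 * αG L * C₁ L * C₃ L * (12 * αG L + αG L * MD L) + αG L * MT L) * (2 * (BV L + BD L) + C₂ L * (2 * (BV L + BD L))))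
      + BH L * (12 * αG L + αG L * MD L) * (2 * (BV L + BD L) + C₂ L * (2 * (BV L + BD L)))),
    hαG0, fun L hL => ?_, fun L hL => ?_, fun L hL => ?_, fun L hL => (hαD' L).trans (hαDq L hL), fun L _ => hα1 L, fun L hL => ?_, ?_⟩
  · exact (mul_le_mul_of_nonneg_left (hαco' L) (by positivity)).trans (hWco L hL)
  · exact (mul_le_mul_of_nonneg_left (hαS' L) (by positivity)).trans (hWS10 L hL)
  · exact (mul_le_mul_of_nonneg_left (hαco' L) (by positivity)).trans (hwinco L hL)
  · have := hBG L hL; have := hBH L hL; have := hC₁ L hL; have := hC₂ L hL; have := hC₃ L hL; have := hBV L hL; have := hBD L hL; have := hMT L hL; have := hMD L hL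
    have := (hαG0 L hL).le
    positivity
  -- the member
  intro L hL i U₀ ρ hreg hρ hlift a ha₀a ha₁a X s hX
  have hc₀L : 0 < c₀ L := (hc₀ L).out
  have hcBL : 0 < cB L := (hcB L).out
  have hL0 : (0 : ℝ) < L := by exact_mod_cast lt_trans zero_lt_one hL
  have hLL : (L : ℝ) = (i.1.1.L : ℝ) := by rw [i.2.1]
  have hαL := hαG0 L hL
  have ha : 0 ≤ a := le_trans (by positivity) ha₀a
  have hs : 0 ≤ s := (norm_nonneg _).trans (hX ⟨Classical.arbitrary _, 0⟩)
  have hregG : RegPr i.1.1 i.1.2.1 i.1.2.2 (αG L) U₀ := regPr_mono i.1.1 hρ hreg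
  -- the window of record at this member
  have hw13 : 13 * 10 ^ 14 * (i.1.1.L : ℝ) ^ 3 * αG L ≤ 1 := by
    rw [← hLL]; exact (mul_le_mul_of_nonneg_left (hαco' L) (by positivity)).trans (hwinco L hL)
  -- PosOnto at the two slots
  have hp₀ : PosOnto i.1.1 i.1.2.1 i.1.2.2 i.2.2.le (c₀ L) (cB L) a (DeltaEtaSlot i.1.1 i.1.2.1 i.1.2.2 (c₀ L)) U₀ :=
    posOnto_of_coercive i.2.2.le (cB L) i.2.2 hregG hw13 (hγco L hL) _ (hco L hL i U₀ ρ hreg (hρ.trans (hαco' L)) hlift a ha₀a)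
  have hp₁ : PosOnto i.1.1 i.1.2.1 i.1.2.2 i.2.2.le (c₀ L) (cB L) a
      (DeltaOneP i.1.1 i.1.2.1 i.1.2.2 i.2.2.le (c₀ L) (cB L) a (TJSlotP i.1.1 i.1.2.1 i.1.2.2 i.2.2.le (c₀ L) (cB L) a)) U₀ :=
    (hcoJ L hL i U₀ ρ hreg (hρ.trans (hαcJ' L)) hlift a ha₀a ha₁a).2.1
  -- the letters at this member
  obtain ⟨hV, hDiv⟩ := hS L hL i U₀ ρ hreg (hρ.trans (hαS' L)) hlift a ha₀a ha₁a
  have hc13m := hc13 L hL i U₀ ρ hreg (hρ.trans (hαX' L)) hlift a ha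
  have hc1 := fun (w : Site (i.1.1.P i.1.2.2) 0 → Matrix (Fin 2) (Fin 2) ℂ) (m' : ℝ) (hw : ∀ x, ‖w x‖ ≤ m') => (hc13m w m' hw).1
  have hc3 := fun (w : Site (i.1.1.P i.1.2.2) 0 → Matrix (Fin 2) (Fin 2) ℂ) (m' : ℝ) (hw : ∀ x, ‖w x‖ ≤ m') => (hc13m w m' hw).2
  have hc2m := hc2 L hL i U₀ ρ hreg (hρ.trans (hαX' L)) hlift a ha
  have hHDm := hHD L hL i U₀ ρ hreg (hρ.trans (hαH' L)) hlift a ha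
  have hG0m := hG0 L hL i U₀ ρ hreg (hρ.trans (hαN' L)) hlift a ha₀a ha₁a
  -- (tJ): the sup row of `T_Jᴾ` at `ρ' := αG L`
  have hTJ : ∀ (Y : PBond (i.1.1.P i.1.2.2) 0 → Matrix (Fin 2) (Fin 2) ℂ) (s' : ℝ), (∀ b, ‖Y b‖ ≤ s') →
      ∀ b, ‖(toL2 i.1.1 i.1.2.2 (c₀ L)).symm (TJSlotP i.1.1 i.1.2.1 i.1.2.2 i.2.2.le (c₀ L) (cB L) a U₀ (toL2 i.1.1 i.1.2.2 (c₀ L) Y)) b‖ ≤ (αG L * MT L) * s' :=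
    (hT L hL i U₀ ρ hreg (hρ.trans (hαT' L)) hlift a ha₀a ha₁a).1 (αG L) hαL.le (hαT' L) hregG
  -- (tJd): the divergence row of `T_Jᴾ` at `ρ' := αG L`, rate `δ := 0` (modulo `hqG`)
  have hTJd : ∀ (Y : PBond (i.1.1.P i.1.2.2) 0 → Matrix (Fin 2) (Fin 2) ℂ) (s' : ℝ), (∀ b, ‖Y b‖ ≤ s') →
      ∀ x, ‖(toL2S i.1.1 i.1.2.2 (c₀ L)).symm (DstarL2 i.1.1 i.1.2.1 i.1.2.2 (c₀ L) U₀
        (TJSlotP i.1.1 i.1.2.1 i.1.2.2 i.2.2.le (c₀ L) (cB L) a U₀ (toL2 i.1.1 i.1.2.2 (c₀ L) Y))) x‖ ≤ (αG L * MD L) * s' := by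
    intro Y s' hY x
    have hs' : 0 ≤ s' := (norm_nonneg _).trans (hY ⟨Classical.arbitrary _, 0⟩)
    have hrow := (hD L hL i U₀ ρ hreg (hρ.trans (hαD' L)) hlift a ha₀a ha₁a).1 (αG L) hαL (hαD' L) hregG 0 le_rfl
      (Classical.arbitrary _) Y s' hs' (fun b => by rw [zero_mul, neg_zero, Real.exp_zero, mul_one]; exact hY b) x
    simpa only [zero_mul, neg_zero, Real.exp_zero, mul_one] using hrow
  -- the window
  have hwin : 4 * αG L * C₁ L * (BV L + BD L) + ((12 * αG L + αG L * MD L) * C₃ L * (1 + C₂ L + 4 * αG L * C₁ L * (BV L + BD L)) + (αG L * MT L) * (BV L + BD L)) * (1 + C₂ L)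
      ≤ 1 / 2 := by
    refine hwinJ_of_cap hαL.le (hα1 L) (hC₁ L hL) (hC₂ L hL) (hC₃ L hL) (add_nonneg (hBV L hL) (hBD L hL)) (hMT L hL) (hMD L hL) ?_
    have hWL := hW0 L hL
    have h1 := hαW L
    rw [le_div_iff₀ (by positivity)] at h1
    simpa only [hWd] using h1
  -- (V1)(Div1) at the J-slot, `(A, ‖A‖)` currency
  have hMTL := hMT L hL; have hMDL := hMD L hL; have hBVL := hBV L hL; have hBDL := hBD L hL; have hαGle := hαL.le
  have hCT0 : 0 ≤ αG L * MT L := mul_nonneg hαGle hMTL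
  have hCTD0 : 0 ≤ αG L * MD L := mul_nonneg hαGle hMDL
  have hB2 : 0 ≤ 2 * (BV L + BD L) := by positivity
  have hVD := fun (A : PBond (i.1.1.P i.1.2.2) 0 → Matrix (Fin 2) (Fin 2) ℂ) =>
    valueDiv_rows_GTone_of_letters (TJSlotP i.1.1 i.1.2.1 i.1.2.2 i.2.2.le (c₀ L) (cB L) a) U₀ hregG ha hp₀ hp₁
      (hBV L hL) (hBD L hL) (hC₁ L hL) (hC₂ L hL) (hC₃ L hL) hCT0 hCTD0 hV hDiv hc1 hc2m hc3 hTJ hTJd hwin A (s := ‖A‖) (fun b => norm_le_pi_norm A b)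
  have hV1 := fun (A : PBond (i.1.1.P i.1.2.2) 0 → Matrix (Fin 2) (Fin 2) ℂ) => (hVD A).1
  have hD1 := fun (A : PBond (i.1.1.P i.1.2.2) 0 → Matrix (Fin 2) (Fin 2) ℂ) => (hVD A).2
  exact gradient_row_GTone_of_letters_sup (TJSlotP i.1.1 i.1.2.1 i.1.2.2 i.2.2.le (c₀ L) (cB L) a) U₀ hregG ha hp₀ hp₁
    hB2 hB2 (hC₁ L hL) (hC₂ L hL) (hC₃ L hL) hCT0 hCTD0 (hBG L hL) (hBH L hL)
    hV1 hD1 hc1 hc2m hc3 hTJ hTJd hG0m hHDm X s hX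

end Summit.QuantumFields.YangMills.Theorems.Prop7GreenOneGradientFamilyAllMembers

end
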